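import Summits.QuantumFields.YangMills.Theorems.BalabanUVNodesN15CurvedGaugeCovariance
import Summits.QuantumFields.YangMills.Theorems.BalabanUVNodesN15CurvedGluingCubeSandwichDefect
import HarnessLib

/-!
# Route «BalabanUVNodes» (cluster K4 «SpineRates»), Track-A DAG node N15 = NE2, BACKGROUND LAYER — PER-CUBE GAUGES ((3.34)∕(3.35)) FOR THE DRESSED CUBE: `hloc` modulo a
# defect, input∕output localizations, remainder-commutator rows, two-sided letters and two-grid η-defects of a cube operator ALL transfer from the cube's local gauge to the
# global gauge under `X ↦ M_{Wᵀ}∘X∘M_W` — exactly for the identities, with the crude factor `|ι|²` for the letters, with two displayed fit terms for η-defects in unrelated gauges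

Cell `pub-ymgap`, seat `pub-ymgap-dag-n15-w2` (WIDTH SEAT 2∕3 on node N15, director-ym №197 ∕ HUMAN RULING D-0149), g4; dag-n15-w3 g3's located item (i) «per-cube GAUGES» of
`HOME/pub-ymgap-dag-n15-w3/HANDOFF.md` («free unless named», for «a width seat»), this seat's g2 lineage (the gauge-action ∕ orthogonality MODEL of the curved-`U` transporter forms:
`…N15AdjointGaugeAction`, `…N15CurvedTransporterOrthogonality(UN)`).  `bears_on: R4∕N15 · K3⁷ SpineGivenEndpointR13SepCoPH (stmt-QuantumFields-20544)`.  Filed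
`--kind proof --supports stmt-QuantumFields-20544 --as helper` — COUNT-NEUTRAL.  Theorems only, 0 `def`, 0 `sorry`.  Imports BY NAME dag-n15-w3 g0 `…N15CurvedGaugeCovariance`
(`trGaugeActFwd`, `gaugePair_trGaugeActFwd`, `covLapM_trGaugeAct`, `mmulOp_transpose_comp`, `mmulOp_comp_transpose`, `mmulOp_transpose_comp_cancel`, `rowSum_le_card_of_entry_le_one`;
through it file 1 `gaugePair`, `abs_entry_le_one_of_orthogonal`, n15-b parts 14∕18 `mmulOp`, `mmulOp_comp_mmulOp`, `hasMaj_mmulOp`, `hasMaj_idef_mmulOp`, `liftMap`, `liftBlk`, dag-n15-c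
FILE 28 `covLapM`) and file 22 `…CurvedGluingCubeSandwichDefect` (`mulOp_fst_comm_mmulOp`; through it dag-n15-c `Gluing.commOp`, lit `mulOp`, `idef`, `pull`, `diagK`, `HasMaj`,
`hasMaj_comp`); nothing in the tree is modified, no landed name re-declared.

WHY.  [Balaban1985BackgroundPropagators] (3.34)–(3.35) p. 396: a GENERAL small-field background `U` is small only CUBE BY CUBE, each cube `□` in ITS OWN gauge `u_□` («there
exists a gauge transformation u on □ such that U^u = e^{iηA}, |A| < O(1)Mα₀(L^jη)^{−1} … on □»).  The per-cube device of this lineage (files 16–31: the dressed cube `X_□`, its `hloc`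
modulo a defect `M_χ(Δ − 𝒱)X = M_χ + E`, its two-sided rows `1_S1_S·βe^{−ρd}`, its remainder rows `[Δ, M_h]∘X` ∕ `X∘[Δ, M_h]`, its two-grid η-defects) is PRODUCED in the local gauge,
where the species letters hold; dag-n15-c's gluing knit CONSUMES the rows of all cubes in ONE global gauge.  This file is the transfer between the two, for a site-wise orthogonal
gauge transformation `W : X → O(ι)` (`WWᵀ = WᵀW = 1`; fields `f ↦ M_Wf`, operators `T ↦ T^W := M_W∘T∘M_{Wᵀ}`):
* §1 EXACT ALGEBRA — conjugation is multiplicative and additive; SITE cut-offs are gauge INVARIANT (`M_χ^W = M_χ`; file 22 `mulOp_fst_comm_mmulOp`), so the localizations `M_χX = X`,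
  `XM_ψ = X` pass to `X^W`; ★★ `hloc_defect_gaugeConj`: `M_χ∘Δ∘X = M_χ + E ⟹ M_χ∘Δ^W∘X^W = M_χ + E^W`; `commOp_gaugeConj`: `[T, M_h]^W = [T^W, M_h]` (dag-n15-c `commOp`), hence BOTH
  arrangements `[Δ, M_h]∘X`, `X∘[Δ, M_h]` of FILE 55∕58's rows conjugate; gauge actions compose and invert (`(R^{W₂})^{W₁} = R^{W₁W₂}`, `(R^W)^{Wᵀ} = R`); ★★ `covLapM_conj_back`:
  `M_{Wᵀ}∘Δ_{gaugePair R^W}∘M_W = Δ_{gaugePair R}` (g0 `covLapM_trGaugeAct` read backwards); ★★★ `hloc_defect_of_localGauge` ∕ `inverse_of_localGauge`: a cube parametrix (resp. an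
  inverse) `X′` of `Δ_{gaugePair R^W} + P′` with defect `E′` IN THE LOCAL GAUGE is, conjugated back (`X := M_{Wᵀ}X′M_W`), one of `Δ_{gaugePair R} + M_{Wᵀ}P′M_W` with defect `M_{Wᵀ}E′M_W`
  IN THE GLOBAL GAUGE — each cube may be computed in its own gauge of (3.35);
* §2 LETTERS — for ANY non-negative kernel `K` (two-sided `1_S(y)1_S(y′)·βe^{−ρd}`, one-sided, plain): `T ≤ K ⟹ M_W∘T ≤ |ι|·K`, `T∘M_{W′} ≤ |ι|·K`, `M_W∘T∘M_{W′} ≤ |ι|²·K` for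
  entrywise `|W|, |W′| ≤ 1` (every orthogonal `W`; g0's `hasMaj_mmulOp_conj` is the case `K = ae^{−ρd}`): EVERY row shape of FILE 55∕58 survives the gauge change with `|ι|²`;
* §3 TWO GRIDS — `pull (liftMap π ι) ∘ M_W = M_{W∘π} ∘ pull (liftMap π ι)` (exact); ★★ in the PULLED-BACK gauge `W∘π` the η-defect conjugates EXACTLY, `𝔇(T′^{W∘π}, T^W) =
  M_{W∘π}∘𝔇(T′, T)∘M_{Wᵀ} ≤ |ι|²·K_𝔇`; ★★★ for two UNRELATED per-cube gauges `W′` (fine), `W` (coarse) the three-factor Leibniz rule `𝔇(T′^{W′}, T^W) = M_{W′}𝔇(T′,T)M_{Wᵀ} +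
  𝔇(M_{W′}, M_W)∘T∘M_{Wᵀ} + M_{W′}∘T′∘𝔇(M_{W′ᵀ}, M_{Wᵀ})` with the displayed max-row-sum FITS `Σ_j|W′(x′) − W(πx′)|_{ij} ≤ o(blk πx′)` (and for the transposes) gives the row
  `≤ |ι|²K_𝔇(y,y′) + |ι|(o(y)K(y,y′) + K′(y,y′)o(y′))` — the (3.42)-type η-rate of a cube operator survives a change of per-cube gauges agreeing up to `o` across the grids.

HONEST FRAMING ∕ LIMITS.  Finite-dimensional conjugation algebra + crude `|ι|`, `|ι|²` letters over DISPLAYED cube rows; nothing is inhabited at the tree's objects here beyond what the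
cited files inhabit; [B9] (3.34)–(3.35) p. 396, (3.42) p. 397, (3.50) p. 400 = SHAPES ∕ MECHANISM — nothing of [B5]∕[B6]∕[B9] asserted.  What this does NOT do: PRODUCE the local gauge
`u_□` of (3.35) with its small-field letters (that is [B6]∕[B9]'s small-field geometry — Lemma 2 of [Balaban1985Averaging]-type axial-gauge constructions, lane-held), nor any estimate
in it; nor the optimal factor (`|ι|²` is crude).  NE2⁺ NOT PRINTED, NOT proved; N15 NOT discharged; K3⁷ OPEN, not claimed, skeleton v5 untouched; counts of record UNMOVED (typed
28∕28 · discharged 5∕27 · A 5∕28); no summit statement is proved here; one finite 𝕋⁴ at fixed ε — NOT ℝ⁴ ∕ OS ∕ mass gap ∕ Clay; R4 closes the rung `BalabanLadder.UV` only.  Restate-immune.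
-/

set_option autoImplicit false

noncomputable section
open scoped BigOperators Matrix

namespace Summit.QuantumFields.YangMills.BalabanUVNodes.N15.CurvedSpecies

open Literature.MathematicalPhysics.QuantumFieldTheory.Balaban1983to89
open Literature.MathematicalPhysics.QuantumFieldTheory.Balaban1983to89.B11SectG (BlockNorm HasMaj hasMaj_comp)
open Literature.MathematicalPhysics.QuantumFieldTheory.Balaban1983to89.B6Prop26Gluing (mulOp mulOp_apply ind ind_nonneg)
open Literature.MathematicalPhysics.QuantumFieldTheory.Balaban1983to89.T4EtaRateDefect (idef idef_apply idef_comp)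
open Literature.MathematicalPhysics.QuantumFieldTheory.Balaban1983to89.T4EtaRateCoeffDefect (pull pull_apply diagK diagK_nonneg)
open Summit.QuantumFields.YangMills.BalabanUVNodes.N15.DerivDefect (sum_diagK_mul sum_mul_diagK)
open Summit.QuantumFields.YangMills.BalabanUVNodes.N15.MatrixSpecies (mmulOp mmulOp_apply liftMap liftBlk mmulOp_comp_mmulOp hasMaj_mmulOp hasMaj_idef_mmulOp)
open Summit.QuantumFields.YangMills.BalabanUVNodes.N15.BackgroundLayer (covLapM)
open Summit.QuantumFields.YangMills.BalabanUVNodes.N15.BackgroundModel (kappa_ofBlocks)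
open Summit.QuantumFields.YangMills.BalabanUVNodes.N15.Gluing (commOp)

variable {X ι : Type} [Fintype ι]

/-! ## §1 Exact conjugation algebra: products, site cut-offs, `hloc` modulo a defect, commutator rows, the covariant Laplacian read backwards -/

section Algebra

variable [DecidableEq ι] (W : X → Matrix ι ι ℝ)

/-- CONJUGATION IS MULTIPLICATIVE: `(M_W∘T∘M_{Wᵀ})∘(M_W∘S∘M_{Wᵀ}) = M_W∘(T∘S)∘M_{Wᵀ}` for `WᵀW = 1`. [folklore] -/
theorem gaugeConj_comp_gaugeConj (hW' : ∀ x, (W x)ᵀ * W x = 1) (T S : (X × ι → ℝ) →ₗ[ℝ] (X × ι → ℝ)) :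
    (mmulOp W ∘ₗ T ∘ₗ mmulOp (fun x => (W x)ᵀ)) ∘ₗ (mmulOp W ∘ₗ S ∘ₗ mmulOp (fun x => (W x)ᵀ)) = mmulOp W ∘ₗ (T ∘ₗ S) ∘ₗ mmulOp (fun x => (W x)ᵀ) := by
  simp only [LinearMap.comp_assoc, mmulOp_transpose_comp_cancel W hW']

omit [DecidableEq ι] in
/-- Conjugation is additive. [folklore] -/
theorem gaugeConj_add (T S : (X × ι → ℝ) →ₗ[ℝ] (X × ι → ℝ)) :
    mmulOp W ∘ₗ (T + S) ∘ₗ mmulOp (fun x => (W x)ᵀ) = mmulOp W ∘ₗ T ∘ₗ mmulOp (fun x => (W x)ᵀ) + mmulOp W ∘ₗ S ∘ₗ mmulOp (fun x => (W x)ᵀ) := by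
  rw [LinearMap.add_comp, LinearMap.comp_add]

omit [DecidableEq ι] in
/-- Conjugation respects differences (`(Δ − 𝒱)^W = Δ^W − 𝒱^W`). [folklore] -/
theorem gaugeConj_sub (T S : (X × ι → ℝ) →ₗ[ℝ] (X × ι → ℝ)) :
    mmulOp W ∘ₗ (T - S) ∘ₗ mmulOp (fun x => (W x)ᵀ) = mmulOp W ∘ₗ T ∘ₗ mmulOp (fun x => (W x)ᵀ) - mmulOp W ∘ₗ S ∘ₗ mmulOp (fun x => (W x)ᵀ) := by
  rw [LinearMap.sub_comp, LinearMap.comp_sub]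

/-- UNDOING A CONJUGATION: `M_{Wᵀ}∘(M_W∘T∘M_{Wᵀ})∘M_W = T` for `WᵀW = 1`. [folklore] -/
theorem transpose_gaugeConj_cancel (hW' : ∀ x, (W x)ᵀ * W x = 1) (T : (X × ι → ℝ) →ₗ[ℝ] (X × ι → ℝ)) :
    mmulOp (fun x => (W x)ᵀ) ∘ₗ (mmulOp W ∘ₗ T ∘ₗ mmulOp (fun x => (W x)ᵀ)) ∘ₗ mmulOp W = T := by
  have h := mmulOp_transpose_comp W hW'
  simp only [LinearMap.comp_assoc]
  rw [h, LinearMap.comp_id, ← LinearMap.comp_assoc, h, LinearMap.id_comp]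

/-- SITE CUT-OFFS ARE GAUGE INVARIANT: `M_W∘M_χ∘M_{Wᵀ} = M_χ` for a site function `χ` (`WWᵀ = 1`). [cite: Balaban1985BackgroundPropagators, (3.35) p.396 (shape)] -/
theorem gaugeConj_mulOp_site (hW : ∀ x, W x * (W x)ᵀ = 1) (χX : X → ℝ) :
    mmulOp W ∘ₗ mulOp (fun p : X × ι => χX p.1) ∘ₗ mmulOp (fun x => (W x)ᵀ) = mulOp (fun p : X × ι => χX p.1) := by
  rw [mulOp_fst_comm_mmulOp, ← LinearMap.comp_assoc, mmulOp_comp_transpose W hW, LinearMap.id_comp]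

omit [DecidableEq ι] in
/-- An output cut-off passes inside a conjugation: `M_χ∘(M_W∘T∘M_{Wᵀ}) = M_W∘(M_χ∘T)∘M_{Wᵀ}`. [folklore] -/
theorem mulOp_comp_gaugeConj (χX : X → ℝ) (T : (X × ι → ℝ) →ₗ[ℝ] (X × ι → ℝ)) :
    mulOp (fun p : X × ι => χX p.1) ∘ₗ (mmulOp W ∘ₗ T ∘ₗ mmulOp (fun x => (W x)ᵀ)) = mmulOp W ∘ₗ (mulOp (fun p : X × ι => χX p.1) ∘ₗ T) ∘ₗ mmulOp (fun x => (W x)ᵀ) := by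
  rw [← LinearMap.comp_assoc, mulOp_fst_comm_mmulOp]
  simp only [LinearMap.comp_assoc]

omit [DecidableEq ι] in
/-- An input cut-off passes inside a conjugation: `(M_W∘T∘M_{Wᵀ})∘M_ψ = M_W∘(T∘M_ψ)∘M_{Wᵀ}`. [folklore] -/
theorem gaugeConj_comp_mulOp (ψX : X → ℝ) (T : (X × ι → ℝ) →ₗ[ℝ] (X × ι → ℝ)) :
    (mmulOp W ∘ₗ T ∘ₗ mmulOp (fun x => (W x)ᵀ)) ∘ₗ mulOp (fun p : X × ι => ψX p.1) = mmulOp W ∘ₗ (T ∘ₗ mulOp (fun p : X × ι => ψX p.1)) ∘ₗ mmulOp (fun x => (W x)ᵀ) := by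
  simp only [LinearMap.comp_assoc]
  rw [mulOp_fst_comm_mmulOp]

omit [DecidableEq ι] in
/-- ★ OUTPUT LOCALIZATION IS GAUGE INVARIANT: `M_χ∘X = X ⟹ M_χ∘X^W = X^W`. [cite: Balaban1984PropagatorsII, (2.133) p.247 (shape)] -/
theorem mulOp_comp_gaugeConj_eq_self {χX : X → ℝ} {T : (X × ι → ℝ) →ₗ[ℝ] (X × ι → ℝ)} (hT : mulOp (fun p : X × ι => χX p.1) ∘ₗ T = T) :
    mulOp (fun p : X × ι => χX p.1) ∘ₗ (mmulOp W ∘ₗ T ∘ₗ mmulOp (fun x => (W x)ᵀ)) = mmulOp W ∘ₗ T ∘ₗ mmulOp (fun x => (W x)ᵀ) := by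
  rw [mulOp_comp_gaugeConj, hT]

omit [DecidableEq ι] in
/-- ★ INPUT LOCALIZATION IS GAUGE INVARIANT: `X∘M_ψ = X ⟹ X^W∘M_ψ = X^W`. [cite: Balaban1984PropagatorsII, (2.133) p.247 (shape)] -/
theorem gaugeConj_comp_mulOp_eq_self {ψX : X → ℝ} {T : (X × ι → ℝ) →ₗ[ℝ] (X × ι → ℝ)} (hT : T ∘ₗ mulOp (fun p : X × ι => ψX p.1) = T) :
    (mmulOp W ∘ₗ T ∘ₗ mmulOp (fun x => (W x)ᵀ)) ∘ₗ mulOp (fun p : X × ι => ψX p.1) = mmulOp W ∘ₗ T ∘ₗ mmulOp (fun x => (W x)ᵀ) := by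
  rw [gaugeConj_comp_mulOp, hT]

/-- ★★ **`hloc` MODULO A DEFECT CONJUGATES**: `M_χ∘Δ∘X = M_χ + E ⟹ M_χ∘Δ^W∘X^W = M_χ + E^W` (`T^W = M_W∘T∘M_{Wᵀ}`, `WWᵀ = WᵀW = 1`) — the cube's local inversion identity is the
same in every gauge. [cite: Balaban1984PropagatorsII, (2.91) p.239 (mechanism); Balaban1985BackgroundPropagators, (3.35) p.396, (3.65) p.403 (shapes)] -/
theorem hloc_defect_gaugeConj (hW : ∀ x, W x * (W x)ᵀ = 1) (hW' : ∀ x, (W x)ᵀ * W x = 1) {χX : X → ℝ} {Δ G E : (X × ι → ℝ) →ₗ[ℝ] (X × ι → ℝ)}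
    (hloc : mulOp (fun p : X × ι => χX p.1) ∘ₗ Δ ∘ₗ G = mulOp (fun p : X × ι => χX p.1) + E) :
    mulOp (fun p : X × ι => χX p.1) ∘ₗ (mmulOp W ∘ₗ Δ ∘ₗ mmulOp (fun x => (W x)ᵀ)) ∘ₗ (mmulOp W ∘ₗ G ∘ₗ mmulOp (fun x => (W x)ᵀ)) =
      mulOp (fun p : X × ι => χX p.1) + mmulOp W ∘ₗ E ∘ₗ mmulOp (fun x => (W x)ᵀ) := by
  rw [gaugeConj_comp_gaugeConj W hW', mulOp_comp_gaugeConj, hloc, gaugeConj_add, gaugeConj_mulOp_site W hW]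

/-- ★ **`hloc` CONJUGATES** (defect-free case): `M_χ∘Δ∘X = M_χ ⟹ M_χ∘Δ^W∘X^W = M_χ`. [cite: Balaban1984PropagatorsII, (2.91) p.239 (mechanism); Balaban1985BackgroundPropagators, (3.35) p.396] -/
theorem hloc_gaugeConj (hW : ∀ x, W x * (W x)ᵀ = 1) (hW' : ∀ x, (W x)ᵀ * W x = 1) {χX : X → ℝ} {Δ G : (X × ι → ℝ) →ₗ[ℝ] (X × ι → ℝ)}
    (hloc : mulOp (fun p : X × ι => χX p.1) ∘ₗ Δ ∘ₗ G = mulOp (fun p : X × ι => χX p.1)) :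
    mulOp (fun p : X × ι => χX p.1) ∘ₗ (mmulOp W ∘ₗ Δ ∘ₗ mmulOp (fun x => (W x)ᵀ)) ∘ₗ (mmulOp W ∘ₗ G ∘ₗ mmulOp (fun x => (W x)ᵀ)) = mulOp (fun p : X × ι => χX p.1) := by
  have h := hloc_defect_gaugeConj W hW hW' (E := 0) (by rw [hloc, add_zero])
  rwa [LinearMap.zero_comp, LinearMap.comp_zero, add_zero] at h

omit [DecidableEq ι] in
/-- ★ **THE REMAINDER COMMUTATOR CONJUGATES**: `[T, M_h]^W = [T^W, M_h]` for a site function `h` (dag-n15-c `commOp T h = T∘M_h − M_h∘T`). [cite: Balaban1984PropagatorsII, (2.93) p.239 (shape)] -/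
theorem commOp_gaugeConj (hX : X → ℝ) (T : (X × ι → ℝ) →ₗ[ℝ] (X × ι → ℝ)) :
    commOp (mmulOp W ∘ₗ T ∘ₗ mmulOp (fun x => (W x)ᵀ)) (fun p : X × ι => hX p.1) = mmulOp W ∘ₗ commOp T (fun p : X × ι => hX p.1) ∘ₗ mmulOp (fun x => (W x)ᵀ) := by
  simp only [commOp, gaugeConj_sub, ← gaugeConj_comp_mulOp, ← mulOp_comp_gaugeConj]

/-- THE LEFT ARRANGEMENT `[T, M_h]∘X` OF FILE 55∕58's remainder rows conjugates: `[T^W, M_h]∘X^W = ([T, M_h]∘X)^W` (`WᵀW = 1`). [cite: Balaban1984PropagatorsII, (2.93) p.239 (shape)] -/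
theorem commOp_comp_gaugeConj (hW' : ∀ x, (W x)ᵀ * W x = 1) (hX : X → ℝ) (T G : (X × ι → ℝ) →ₗ[ℝ] (X × ι → ℝ)) :
    commOp (mmulOp W ∘ₗ T ∘ₗ mmulOp (fun x => (W x)ᵀ)) (fun p : X × ι => hX p.1) ∘ₗ (mmulOp W ∘ₗ G ∘ₗ mmulOp (fun x => (W x)ᵀ)) =
      mmulOp W ∘ₗ (commOp T (fun p : X × ι => hX p.1) ∘ₗ G) ∘ₗ mmulOp (fun x => (W x)ᵀ) := by
  rw [commOp_gaugeConj, gaugeConj_comp_gaugeConj W hW']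

/-- THE ADJOINT ARRANGEMENT `X∘[T, M_h]` (FILE 58 `hKcL`∕`hDKL`) conjugates: `X^W∘[T^W, M_h] = (X∘[T, M_h])^W` (`WᵀW = 1`). [cite: Balaban1984PropagatorsII, (2.93) p.239 (shape)] -/
theorem comp_commOp_gaugeConj (hW' : ∀ x, (W x)ᵀ * W x = 1) (hX : X → ℝ) (T G : (X × ι → ℝ) →ₗ[ℝ] (X × ι → ℝ)) :
    (mmulOp W ∘ₗ G ∘ₗ mmulOp (fun x => (W x)ᵀ)) ∘ₗ commOp (mmulOp W ∘ₗ T ∘ₗ mmulOp (fun x => (W x)ᵀ)) (fun p : X × ι => hX p.1) =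
      mmulOp W ∘ₗ (G ∘ₗ commOp T (fun p : X × ι => hX p.1)) ∘ₗ mmulOp (fun x => (W x)ᵀ) := by
  rw [commOp_gaugeConj, gaugeConj_comp_gaugeConj W hW']

variable {J : Type} [Fintype J] (τ : J → X ≃ X)

omit [DecidableEq ι] [Fintype J] in
/-- GAUGE ACTIONS COMPOSE: `(R^{W₂})^{W₁} = R^{W₁W₂}`. [folklore] -/
theorem trGaugeActFwd_trGaugeActFwd (W₁ W₂ : X → Matrix ι ι ℝ) (R : J → X → Matrix ι ι ℝ) :
    trGaugeActFwd τ W₁ (trGaugeActFwd τ W₂ R) = trGaugeActFwd τ (fun x => W₁ x * W₂ x) R := by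
  funext μ x
  simp only [trGaugeActFwd, Matrix.transpose_mul, Matrix.mul_assoc]

omit [Fintype J] in
/-- The trivial gauge transformation does nothing: `R^1 = R`. [folklore] -/
theorem trGaugeActFwd_one (R : J → X → Matrix ι ι ℝ) : trGaugeActFwd τ (fun _ : X => (1 : Matrix ι ι ℝ)) R = R := by
  funext μ x
  simp only [trGaugeActFwd, Matrix.transpose_one, Matrix.one_mul, Matrix.mul_one]

omit [Fintype J] in
/-- UNDOING A GAUGE TRANSFORMATION: `(R^W)^{Wᵀ} = R` for `WᵀW = 1`. [folklore] -/
theorem trGaugeActFwd_transpose_trGaugeActFwd (hW' : ∀ x, (W x)ᵀ * W x = 1) (R : J → X → Matrix ι ι ℝ) :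
    trGaugeActFwd τ (fun x => (W x)ᵀ) (trGaugeActFwd τ W R) = R := by
  rw [trGaugeActFwd_trGaugeActFwd, show (fun x => (W x)ᵀ * W x) = fun _ : X => (1 : Matrix ι ι ℝ) from funext hW', trGaugeActFwd_one]

/-- ★★ **BAŁABAN's COVARIANT LAPLACIAN READ BACKWARDS**: `M_{Wᵀ}∘Δ_{gaugePair R^W}∘M_W = Δ_{gaugePair R}` (`WWᵀ = WᵀW = 1`; g0 `covLapM_trGaugeAct`) — the operator at the background is the
conjugate, by the INVERSE gauge transformation, of the operator at the gauge-transformed background. [cite: Balaban1985BackgroundPropagators, (3.35) p.396, (3.50) p.400] -/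
theorem covLapM_conj_back (η : ℝ) (hW : ∀ x, W x * (W x)ᵀ = 1) (hW' : ∀ x, (W x)ᵀ * W x = 1) (R : J → X → Matrix ι ι ℝ) :
    mmulOp (fun x => (W x)ᵀ) ∘ₗ covLapM τ η (gaugePair τ (trGaugeActFwd τ W R)) ∘ₗ mmulOp W = covLapM τ η (gaugePair τ R) := by
  rw [gaugePair_trGaugeActFwd, covLapM_trGaugeAct η τ W hW]
  exact transpose_gaugeConj_cancel W hW' _

/-- ★★★ **PER-CUBE GAUGES — THE LOCAL-GAUGE TRANSFER OF `hloc` MODULO A DEFECT.**  If, IN THE LOCAL GAUGE `W` of a cube ((3.35): there `U^W = e^{iηA}` with `A` small, so the species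
letters and files 16–31 apply), `X′` is a cube parametrix of the operator `Δ_{gaugePair R^W} + P′` behind the cut-off `χ` with defect `E′` (`M_χ∘(Δ_{gaugePair R^W} + P′)∘X′ = M_χ + E′`),
then, CONJUGATED BACK TO THE GLOBAL GAUGE, `X := M_{Wᵀ}∘X′∘M_W` is a cube parametrix of `Δ_{gaugePair R} + M_{Wᵀ}∘P′∘M_W` behind the same cut-off with defect `M_{Wᵀ}∘E′∘M_W` — for a
gauge-covariant remainder `P′ = M_W∘P∘M_{Wᵀ}` this is the operator `Δ_{gaugePair R} + P` at the original background.  Each cube may therefore be computed in its own gauge.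
[cite: Balaban1985BackgroundPropagators, (3.34)–(3.35) p.396, (3.50) p.400, (3.65) p.403 (shapes ∕ mechanism); Balaban1984PropagatorsII, (2.91) p.239] -/
theorem hloc_defect_of_localGauge (η : ℝ) (hW : ∀ x, W x * (W x)ᵀ = 1) (hW' : ∀ x, (W x)ᵀ * W x = 1) (R : J → X → Matrix ι ι ℝ) {χX : X → ℝ}
    {P' G' E' : (X × ι → ℝ) →ₗ[ℝ] (X × ι → ℝ)}
    (hloc' : mulOp (fun p : X × ι => χX p.1) ∘ₗ (covLapM τ η (gaugePair τ (trGaugeActFwd τ W R)) + P') ∘ₗ G' = mulOp (fun p : X × ι => χX p.1) + E') :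
    mulOp (fun p : X × ι => χX p.1) ∘ₗ (covLapM τ η (gaugePair τ R) + mmulOp (fun x => (W x)ᵀ) ∘ₗ P' ∘ₗ mmulOp W) ∘ₗ (mmulOp (fun x => (W x)ᵀ) ∘ₗ G' ∘ₗ mmulOp W) =
      mulOp (fun p : X × ι => χX p.1) + mmulOp (fun x => (W x)ᵀ) ∘ₗ E' ∘ₗ mmulOp W := by
  have hV : ∀ x, (W x)ᵀ * ((W x)ᵀ)ᵀ = 1 := fun x => by rw [Matrix.transpose_transpose]; exact hW' x
  have hV' : ∀ x, ((W x)ᵀ)ᵀ * (W x)ᵀ = 1 := fun x => by rw [Matrix.transpose_transpose]; exact hW x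
  have h := hloc_defect_gaugeConj (fun x => (W x)ᵀ) hV hV' hloc'
  rw [gaugeConj_add (fun x => (W x)ᵀ) (covLapM τ η (gaugePair τ (trGaugeActFwd τ W R))) P'] at h
  simp only [Matrix.transpose_transpose] at h
  rw [covLapM_conj_back W τ η hW hW' R] at h
  exact h

/-- ★★ **INVERSES IN THE LOCAL GAUGE ARE INVERSES IN THE GLOBAL GAUGE**: `(Δ_{gaugePair R^W} + P′)∘G′ = 1 ⟹ (Δ_{gaugePair R} + M_{Wᵀ}P′M_W)∘(M_{Wᵀ}G′M_W) = 1` (g0 `covLapM_trGaugeAct_inverse`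
read backwards through `(R^W)^{Wᵀ} = R`). [cite: Balaban1985BackgroundPropagators, (3.35) p.396, (3.50) p.400 (shapes)] -/
theorem inverse_of_localGauge (η : ℝ) (hW : ∀ x, W x * (W x)ᵀ = 1) (hW' : ∀ x, (W x)ᵀ * W x = 1) (R : J → X → Matrix ι ι ℝ) {P' G' : (X × ι → ℝ) →ₗ[ℝ] (X × ι → ℝ)}
    (hG' : (covLapM τ η (gaugePair τ (trGaugeActFwd τ W R)) + P') ∘ₗ G' = LinearMap.id) :
    (covLapM τ η (gaugePair τ R) + mmulOp (fun x => (W x)ᵀ) ∘ₗ P' ∘ₗ mmulOp W) ∘ₗ (mmulOp (fun x => (W x)ᵀ) ∘ₗ G' ∘ₗ mmulOp W) = LinearMap.id := by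
  have hV : ∀ x, (W x)ᵀ * ((W x)ᵀ)ᵀ = 1 := fun x => by rw [Matrix.transpose_transpose]; exact hW' x
  have hV' : ∀ x, ((W x)ᵀ)ᵀ * (W x)ᵀ = 1 := fun x => by rw [Matrix.transpose_transpose]; exact hW x
  have h := covLapM_trGaugeAct_inverse η τ (fun x => (W x)ᵀ) (trGaugeActFwd τ W R) hV hV' hG'
  simp only [Matrix.transpose_transpose] at h
  rwa [trGaugeActFwd_transpose_trGaugeActFwd W τ hW'] at h

end Algebra

/-! ## §2 Letters: block majorants survive a gauge change with the crude factors `|ι|`, `|ι|²` — for EVERY non-negative kernel (two-sided, one-sided, plain) -/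

section Letters

variable [Fintype X] {g : B6.Geometry} (blk : X → g.Site) {F : Type} [AddCommGroup F] [Module ℝ F] {b : BlockNorm g F}

/-- ★★ **LEFT GAUGE FACTOR**: `T ≤ K` (`K ≥ 0`, any source block norm) and `|W(x)_{ij}| ≤ 1` ⟹ `M_W∘T ≤ |ι|·K`. [cite: Balaban1985BackgroundPropagators, (3.35) p.396, (3.42) p.397 (shapes)] -/
theorem hasMaj_mmulOp_comp_of_entry_le_one {W₀ : X → Matrix ι ι ℝ} {T : F →ₗ[ℝ] (X × ι → ℝ)} {K : g.Site → g.Site → ℝ} (hW1 : ∀ x i j, |W₀ x i j| ≤ 1) (hT : HasMaj b (BlockNorm.ofBlocks g (liftBlk blk ι)) T K) :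
    HasMaj b (BlockNorm.ofBlocks g (liftBlk blk ι)) (mmulOp W₀ ∘ₗ T) (fun y y' => (Fintype.card ι : ℝ) * K y y') := by
  have hι : 0 ≤ (Fintype.card ι : ℝ) := Nat.cast_nonneg _
  have hMW : HasMaj (BlockNorm.ofBlocks g (liftBlk blk ι)) (BlockNorm.ofBlocks g (liftBlk blk ι)) (mmulOp W₀) (diagK fun _ => (Fintype.card ι : ℝ)) :=
    hasMaj_mmulOp blk (fun _ => hι) (fun x i => rowSum_le_card_of_entry_le_one hW1 x i)
  refine (hasMaj_comp hMW hT fun _ _ => diagK_nonneg (fun _ => hι) _ _).mono fun y y' => le_of_eq ?_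
  rw [kappa_ofBlocks]
  simp only [one_mul]
  rw [sum_diagK_mul]

/-- ★★ **RIGHT GAUGE FACTOR**: `T ≤ K` (`K ≥ 0`, any target block norm) and `|W′(x)_{ij}| ≤ 1` ⟹ `T∘M_{W′} ≤ |ι|·K`. [cite: Balaban1985BackgroundPropagators, (3.35) p.396, (3.42) p.397 (shapes)] -/
theorem hasMaj_comp_mmulOp_of_entry_le_one {W' : X → Matrix ι ι ℝ} {T : (X × ι → ℝ) →ₗ[ℝ] F} {K : g.Site → g.Site → ℝ} (hK : ∀ y y', 0 ≤ K y y')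
    (hW1' : ∀ x i j, |W' x i j| ≤ 1) (hT : HasMaj (BlockNorm.ofBlocks g (liftBlk blk ι)) b T K) :
    HasMaj (BlockNorm.ofBlocks g (liftBlk blk ι)) b (T ∘ₗ mmulOp W') (fun y y' => (Fintype.card ι : ℝ) * K y y') := by
  have hι : 0 ≤ (Fintype.card ι : ℝ) := Nat.cast_nonneg _
  have hMW' : HasMaj (BlockNorm.ofBlocks g (liftBlk blk ι)) (BlockNorm.ofBlocks g (liftBlk blk ι)) (mmulOp W') (diagK fun _ => (Fintype.card ι : ℝ)) :=
    hasMaj_mmulOp blk (fun _ => hι) (fun x i => rowSum_le_card_of_entry_le_one hW1' x i)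
  refine (hasMaj_comp hT hMW' hK).mono fun y y' => le_of_eq ?_
  rw [kappa_ofBlocks]
  simp only [one_mul]
  rw [sum_mul_diagK, mul_comm]

/-- ★★ **TWO-SIDED GAUGE FACTORS, ANY KERNEL**: `T ≤ K` (`K ≥ 0`), `|W|, |W′| ≤ 1` entrywise ⟹ `M_W∘T∘M_{W′} ≤ |ι|²·K` — g0's `hasMaj_mmulOp_conj` for an ARBITRARY non-negative kernel, so the
two-sided localized rows `1_S(y)1_S(y′)·βe^{−ρd}` of the dressed cube keep their localizations. [cite: Balaban1985BackgroundPropagators, (3.35) p.396, (3.42) p.397 (shapes)] -/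
theorem hasMaj_sandwich_of_entry_le_one {W₀ W' : X → Matrix ι ι ℝ} {T : (X × ι → ℝ) →ₗ[ℝ] (X × ι → ℝ)} {K : g.Site → g.Site → ℝ} (hK : ∀ y y', 0 ≤ K y y')
    (hW1 : ∀ x i j, |W₀ x i j| ≤ 1) (hW1' : ∀ x i j, |W' x i j| ≤ 1) (hT : HasMaj (BlockNorm.ofBlocks g (liftBlk blk ι)) (BlockNorm.ofBlocks g (liftBlk blk ι)) T K) :
    HasMaj (BlockNorm.ofBlocks g (liftBlk blk ι)) (BlockNorm.ofBlocks g (liftBlk blk ι)) (mmulOp W₀ ∘ₗ T ∘ₗ mmulOp W') (fun y y' => (Fintype.card ι : ℝ) ^ 2 * K y y') := by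
  have hι : 0 ≤ (Fintype.card ι : ℝ) := Nat.cast_nonneg _
  have h1 := hasMaj_comp_mmulOp_of_entry_le_one blk hK hW1' hT
  refine (hasMaj_mmulOp_comp_of_entry_le_one blk hW1 h1).mono fun y y' => le_of_eq ?_
  ring

omit [Fintype X] in
/-- An orthogonal site matrix has entries of modulus `≤ 1` (file 1 `abs_entry_le_one_of_orthogonal`, field form). [folklore] -/
theorem entry_le_one_of_orthogonal [DecidableEq ι] {W₀ : X → Matrix ι ι ℝ} (hW : ∀ x, W₀ x * (W₀ x)ᵀ = 1) (x : X) (i j : ι) : |W₀ x i j| ≤ 1 :=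
  abs_entry_le_one_of_orthogonal (hW x) i j

omit [Fintype X] in
/-- The transposed field of an orthogonal gauge transformation has entries of modulus `≤ 1` (`WᵀW = 1`). [folklore] -/
theorem transpose_entry_le_one_of_orthogonal [DecidableEq ι] {W₀ : X → Matrix ι ι ℝ} (hW' : ∀ x, (W₀ x)ᵀ * W₀ x = 1) (x : X) (i j : ι) : |(W₀ x)ᵀ i j| ≤ 1 := by
  have h : (W₀ x)ᵀ * ((W₀ x)ᵀ)ᵀ = 1 := by rw [Matrix.transpose_transpose]; exact hW' x
  exact abs_entry_le_one_of_orthogonal h i j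

variable [DecidableEq ι] (W : X → Matrix ι ι ℝ)

/-- ★★ **EVERY ROW OF THE CUBE SURVIVES THE GAUGE CHANGE `X ↦ M_W∘X∘M_{Wᵀ}` WITH THE FACTOR `|ι|²`** (`WWᵀ = WᵀW = 1`, any non-negative kernel: two-sided `hG`∕`hD`-shapes, one-sided, plain).
[cite: Balaban1985BackgroundPropagators, (3.35) p.396, (3.42) p.397 (shapes)] -/
theorem hasMaj_gaugeConj (hW : ∀ x, W x * (W x)ᵀ = 1) (hW' : ∀ x, (W x)ᵀ * W x = 1) {T : (X × ι → ℝ) →ₗ[ℝ] (X × ι → ℝ)} {K : g.Site → g.Site → ℝ} (hK : ∀ y y', 0 ≤ K y y')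
    (hT : HasMaj (BlockNorm.ofBlocks g (liftBlk blk ι)) (BlockNorm.ofBlocks g (liftBlk blk ι)) T K) :
    HasMaj (BlockNorm.ofBlocks g (liftBlk blk ι)) (BlockNorm.ofBlocks g (liftBlk blk ι)) (mmulOp W ∘ₗ T ∘ₗ mmulOp (fun x => (W x)ᵀ)) (fun y y' => (Fintype.card ι : ℝ) ^ 2 * K y y') :=
  hasMaj_sandwich_of_entry_le_one blk hK (entry_le_one_of_orthogonal hW) (transpose_entry_le_one_of_orthogonal hW') hT

/-- ★★ **… AND THE INVERSE GAUGE CHANGE `X′ ↦ M_{Wᵀ}∘X′∘M_W`** (local gauge → global gauge, the direction of `hloc_defect_of_localGauge`).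
[cite: Balaban1985BackgroundPropagators, (3.35) p.396, (3.42) p.397 (shapes)] -/
theorem hasMaj_gaugeConj_back (hW : ∀ x, W x * (W x)ᵀ = 1) (hW' : ∀ x, (W x)ᵀ * W x = 1) {T : (X × ι → ℝ) →ₗ[ℝ] (X × ι → ℝ)} {K : g.Site → g.Site → ℝ} (hK : ∀ y y', 0 ≤ K y y')
    (hT : HasMaj (BlockNorm.ofBlocks g (liftBlk blk ι)) (BlockNorm.ofBlocks g (liftBlk blk ι)) T K) :
    HasMaj (BlockNorm.ofBlocks g (liftBlk blk ι)) (BlockNorm.ofBlocks g (liftBlk blk ι)) (mmulOp (fun x => (W x)ᵀ) ∘ₗ T ∘ₗ mmulOp W) (fun y y' => (Fintype.card ι : ℝ) ^ 2 * K y y') :=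
  hasMaj_sandwich_of_entry_le_one blk hK (transpose_entry_le_one_of_orthogonal hW') (entry_le_one_of_orthogonal hW) hT

/-- ★ THE TWO-SIDED LOCALIZED ROW SHAPE (FILE 55 `hG`∕`hD`, files 21∕23∕25 `…_loc₂`): `X ≤ 1_S(y)1_S(y′)·βe^{−ρd} ⟹ X^W ≤ 1_S(y)1_S(y′)·(|ι|²β)e^{−ρd}` (`β ≥ 0`).
[cite: Balaban1984PropagatorsII, (2.133) p.247 (shape); Balaban1985BackgroundPropagators, (3.35) p.396, (3.42) p.397] -/
theorem hasMaj_gaugeConj_loc₂ (hW : ∀ x, W x * (W x)ᵀ = 1) (hW' : ∀ x, (W x)ᵀ * W x = 1) {T : (X × ι → ℝ) →ₗ[ℝ] (X × ι → ℝ)} {S : Set g.Site} {β ρ : ℝ} (hβ : 0 ≤ β)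
    (hT : HasMaj (BlockNorm.ofBlocks g (liftBlk blk ι)) (BlockNorm.ofBlocks g (liftBlk blk ι)) T (fun y y' => ind S y * ind S y' * (β * Real.exp (-(ρ * g.dist y y'))))) :
    HasMaj (BlockNorm.ofBlocks g (liftBlk blk ι)) (BlockNorm.ofBlocks g (liftBlk blk ι)) (mmulOp W ∘ₗ T ∘ₗ mmulOp (fun x => (W x)ᵀ))
      (fun y y' => ind S y * ind S y' * ((Fintype.card ι : ℝ) ^ 2 * β * Real.exp (-(ρ * g.dist y y')))) := by
  refine (hasMaj_gaugeConj blk W hW hW' (fun y y' => ?_) hT).mono fun y y' => le_of_eq (by ring)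
  exact mul_nonneg (mul_nonneg (ind_nonneg S y) (ind_nonneg S y')) (mul_nonneg hβ (Real.exp_nonneg _))

end Letters

/-! ## §3 Two grids: the pull-back intertwines the gauge actions; η-defect rows under a change of per-cube gauges -/

section TwoGrids

variable {X' : Type} (π : X' → X) (W : X → Matrix ι ι ℝ) (W' : X' → Matrix ι ι ℝ)

/-- **THE PULL-BACK OF A GAUGE-TRANSFORMED FIELD IS THE TRANSFORMED PULL-BACK IN THE PULLED-BACK GAUGE**: `pull (liftMap π ι) ∘ M_W = M_{W∘π} ∘ pull (liftMap π ι)` (exact).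
[cite: Balaban1985BackgroundPropagators, (3.42) p.397 (the two grids), (3.35) p.396 (shape)] -/
theorem pull_liftMap_comp_mmulOp : pull (liftMap π ι) ∘ₗ mmulOp W = mmulOp (fun x' => W (π x')) ∘ₗ pull (liftMap π ι) := by
  refine LinearMap.ext fun f => funext fun p => ?_
  simp only [LinearMap.comp_apply, pull_apply, mmulOp_apply]

/-- The gauge multiplications in the pulled-back gauge have NO η-defect: `𝔇(M_{W∘π}, M_W) = 0`. [folklore] -/
theorem idef_mmulOp_pullback : idef (pull (liftMap π ι)) (pull (liftMap π ι)) (mmulOp (fun x' => W (π x'))) (mmulOp W) = 0 := by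
  rw [idef, pull_liftMap_comp_mmulOp, sub_self]

/-- ★★★ **THREE-FACTOR LEIBNIZ FOR CONJUGATES IN TWO GAUGES** (fine gauge `W′` on `X′`, coarse gauge `W` on `X`, `P = pull (liftMap π ι)`):
`𝔇(M_{W′}T′M_{W′ᵀ}, M_WTM_{Wᵀ}) = M_{W′}∘𝔇(T′, T)∘M_{Wᵀ} + 𝔇(M_{W′}, M_W)∘(T∘M_{Wᵀ}) + (M_{W′}∘T′)∘𝔇(M_{W′ᵀ}, M_{Wᵀ})` (lit `idef_comp` twice).
[cite: Balaban1985BackgroundPropagators, (3.42) p.397 (shape of the two-grid comparison)] -/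
theorem idef_gaugeConj_eq (T' : (X' × ι → ℝ) →ₗ[ℝ] (X' × ι → ℝ)) (T : (X × ι → ℝ) →ₗ[ℝ] (X × ι → ℝ)) :
    idef (pull (liftMap π ι)) (pull (liftMap π ι)) (mmulOp W' ∘ₗ T' ∘ₗ mmulOp (fun x' => (W' x')ᵀ)) (mmulOp W ∘ₗ T ∘ₗ mmulOp (fun x => (W x)ᵀ)) =
      mmulOp W' ∘ₗ idef (pull (liftMap π ι)) (pull (liftMap π ι)) T' T ∘ₗ mmulOp (fun x => (W x)ᵀ) +
        idef (pull (liftMap π ι)) (pull (liftMap π ι)) (mmulOp W') (mmulOp W) ∘ₗ (T ∘ₗ mmulOp (fun x => (W x)ᵀ)) +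
        (mmulOp W' ∘ₗ T') ∘ₗ idef (pull (liftMap π ι)) (pull (liftMap π ι)) (mmulOp (fun x' => (W' x')ᵀ)) (mmulOp (fun x => (W x)ᵀ)) := by
  rw [idef_comp, idef_comp]
  simp only [LinearMap.comp_add, LinearMap.comp_assoc]
  abel

/-- ★★ **IN THE PULLED-BACK GAUGE THE η-DEFECT CONJUGATES EXACTLY**: `𝔇(M_{W∘π}T′M_{(W∘π)ᵀ}, M_WTM_{Wᵀ}) = M_{W∘π}∘𝔇(T′, T)∘M_{Wᵀ}`.
[cite: Balaban1985BackgroundPropagators, (3.42) p.397, (3.35) p.396 (shapes)] -/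
theorem idef_gaugeConj_of_pullback (T' : (X' × ι → ℝ) →ₗ[ℝ] (X' × ι → ℝ)) (T : (X × ι → ℝ) →ₗ[ℝ] (X × ι → ℝ)) :
    idef (pull (liftMap π ι)) (pull (liftMap π ι)) (mmulOp (fun x' => W (π x')) ∘ₗ T' ∘ₗ mmulOp (fun x' => (W (π x'))ᵀ)) (mmulOp W ∘ₗ T ∘ₗ mmulOp (fun x => (W x)ᵀ)) =
      mmulOp (fun x' => W (π x')) ∘ₗ idef (pull (liftMap π ι)) (pull (liftMap π ι)) T' T ∘ₗ mmulOp (fun x => (W x)ᵀ) := by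
  rw [idef_gaugeConj_eq, idef_mmulOp_pullback, idef_mmulOp_pullback π (fun x => (W x)ᵀ), LinearMap.zero_comp, LinearMap.comp_zero, add_zero, add_zero]

variable [Fintype X] [Fintype X'] {g : B6.Geometry} (blk : X → g.Site)

/-- ★★ **THE η-DEFECT ROW SURVIVES THE PULLED-BACK GAUGE CHANGE WITH THE FACTOR `|ι|²`**: `𝔇(T′, T) ≤ K_𝔇` (`K_𝔇 ≥ 0`), `|W| ≤ 1` entrywise (and hence `|Wᵀ| ≤ 1`: both displayed) ⟹
`𝔇(T′^{W∘π}, T^W) ≤ |ι|²·K_𝔇` — FILE 55's `hIG`∕`hIGE`∕`hDK`-type rows of a cube in the pulled-back local gauge are rows in the global gauge.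
[cite: Balaban1985BackgroundPropagators, (3.42) p.397, (3.35) p.396 (shapes)] -/
theorem hasMaj_idef_gaugeConj_of_pullback {T' : (X' × ι → ℝ) →ₗ[ℝ] (X' × ι → ℝ)} {T : (X × ι → ℝ) →ₗ[ℝ] (X × ι → ℝ)} {KD : g.Site → g.Site → ℝ} (hKD : ∀ y y', 0 ≤ KD y y')
    (hW1 : ∀ x i j, |W x i j| ≤ 1) (hWt1 : ∀ x i j, |(W x)ᵀ i j| ≤ 1)
    (hDT : HasMaj (BlockNorm.ofBlocks g (liftBlk blk ι)) (BlockNorm.ofBlocks g (liftBlk (blk ∘ π) ι)) (idef (pull (liftMap π ι)) (pull (liftMap π ι)) T' T) KD) :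
    HasMaj (BlockNorm.ofBlocks g (liftBlk blk ι)) (BlockNorm.ofBlocks g (liftBlk (blk ∘ π) ι))
      (idef (pull (liftMap π ι)) (pull (liftMap π ι)) (mmulOp (fun x' => W (π x')) ∘ₗ T' ∘ₗ mmulOp (fun x' => (W (π x'))ᵀ)) (mmulOp W ∘ₗ T ∘ₗ mmulOp (fun x => (W x)ᵀ)))
      (fun y y' => (Fintype.card ι : ℝ) ^ 2 * KD y y') := by
  have hι : 0 ≤ (Fintype.card ι : ℝ) := Nat.cast_nonneg _
  rw [idef_gaugeConj_of_pullback]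
  have h1 := hasMaj_comp_mmulOp_of_entry_le_one blk (b := BlockNorm.ofBlocks g (liftBlk (blk ∘ π) ι)) hKD hWt1 hDT
  have h2 := hasMaj_mmulOp_comp_of_entry_le_one (blk ∘ π) (b := BlockNorm.ofBlocks g (liftBlk blk ι)) (W₀ := fun x' => W (π x')) (fun x' i j => hW1 (π x') i j) h1
  refine h2.mono fun y y' => le_of_eq ?_
  ring

/-- ★★★ **THE η-DEFECT ROW UNDER TWO UNRELATED PER-CUBE GAUGES.**  Fine gauge `W′` on `X′`, coarse gauge `W` on `X`, entrywise `|Wᵀ|, |W′| ≤ 1` (orthogonal), the FITS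
`Σ_j|W′(x′)_{ij} − W(πx′)_{ij}| ≤ o(blk πx′)` and `Σ_j|W′(x′)ᵀ_{ij} − W(πx′)ᵀ_{ij}| ≤ o(blk πx′)` (`o ≥ 0`), the rows `T ≤ K`, `T′ ≤ K′` and the η-defect row `𝔇(T′, T) ≤ K_𝔇` (all `≥ 0`) ⟹
`𝔇(T′^{W′}, T^W) ≤ |ι|²·K_𝔇(y,y′) + |ι|·(o(y)·K(y,y′) + K′(y,y′)·o(y′))` — the (3.42)-type η-rate of a cube operator survives a change of per-cube gauges whose fine and coarse
transformations agree up to the displayed fit `o` (for `W′ = W∘π` the fit vanishes: `hasMaj_idef_gaugeConj_of_pullback`).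
[cite: Balaban1985BackgroundPropagators, (3.42) p.397 (shape), (3.35) p.396; King1986, p.664 (pairing convention)] -/
theorem hasMaj_idef_gaugeConj {T' : (X' × ι → ℝ) →ₗ[ℝ] (X' × ι → ℝ)} {T : (X × ι → ℝ) →ₗ[ℝ] (X × ι → ℝ)} {K K' KD : g.Site → g.Site → ℝ} {o : g.Site → ℝ}
    (hK : ∀ y y', 0 ≤ K y y') (hK' : ∀ y y', 0 ≤ K' y y') (hKD : ∀ y y', 0 ≤ KD y y') (ho : ∀ y, 0 ≤ o y)
    (hWt1 : ∀ x i j, |(W x)ᵀ i j| ≤ 1) (hW1' : ∀ x' i j, |W' x' i j| ≤ 1)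
    (hfit : ∀ x' i, ∑ j, |W' x' i j - W (π x') i j| ≤ o (blk (π x'))) (hfitT : ∀ x' i, ∑ j, |(W' x')ᵀ i j - (W (π x'))ᵀ i j| ≤ o (blk (π x')))
    (hT : HasMaj (BlockNorm.ofBlocks g (liftBlk blk ι)) (BlockNorm.ofBlocks g (liftBlk blk ι)) T K)
    (hT' : HasMaj (BlockNorm.ofBlocks g (liftBlk (blk ∘ π) ι)) (BlockNorm.ofBlocks g (liftBlk (blk ∘ π) ι)) T' K')
    (hDT : HasMaj (BlockNorm.ofBlocks g (liftBlk blk ι)) (BlockNorm.ofBlocks g (liftBlk (blk ∘ π) ι)) (idef (pull (liftMap π ι)) (pull (liftMap π ι)) T' T) KD) :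
    HasMaj (BlockNorm.ofBlocks g (liftBlk blk ι)) (BlockNorm.ofBlocks g (liftBlk (blk ∘ π) ι))
      (idef (pull (liftMap π ι)) (pull (liftMap π ι)) (mmulOp W' ∘ₗ T' ∘ₗ mmulOp (fun x' => (W' x')ᵀ)) (mmulOp W ∘ₗ T ∘ₗ mmulOp (fun x => (W x)ᵀ)))
      (fun y y' => (Fintype.card ι : ℝ) ^ 2 * KD y y' + (Fintype.card ι : ℝ) * (o y * K y y' + K' y y' * o y')) := by
  have hι : 0 ≤ (Fintype.card ι : ℝ) := Nat.cast_nonneg _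
  rw [idef_gaugeConj_eq]
  have h1a := hasMaj_comp_mmulOp_of_entry_le_one blk (b := BlockNorm.ofBlocks g (liftBlk (blk ∘ π) ι)) hKD hWt1 hDT
  have h1 := hasMaj_mmulOp_comp_of_entry_le_one (blk ∘ π) (b := BlockNorm.ofBlocks g (liftBlk blk ι)) hW1' h1a
  have h2a := hasMaj_comp_mmulOp_of_entry_le_one blk (b := BlockNorm.ofBlocks g (liftBlk blk ι)) hK hWt1 hT
  have h2b := hasMaj_idef_mmulOp blk π ho hfit
  have h2 := hasMaj_comp h2b h2a (fun y y' => diagK_nonneg ho y y')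
  have h3a := hasMaj_mmulOp_comp_of_entry_le_one (blk ∘ π) (b := BlockNorm.ofBlocks g (liftBlk (blk ∘ π) ι)) hW1' hT'
  have h3b := hasMaj_idef_mmulOp blk π ho (C' := fun x' => (W' x')ᵀ) (C := fun x => (W x)ᵀ) hfitT
  have h3 := hasMaj_comp h3a h3b (fun y y' => mul_nonneg hι (hK' y y'))
  refine ((h1.add h2).add h3).mono fun y y' => le_of_eq ?_
  rw [kappa_ofBlocks, kappa_ofBlocks]
  simp only [one_mul]
  rw [sum_diagK_mul, sum_mul_diagK]
  ring

/-- ★★ EXPONENTIAL EDITION: rows `βe^{−δd}` at both grids, defect row `m_𝔇e^{−δd}`, constant fit `o` ⟹ `𝔇(T′^{W′}, T^W) ≤ (|ι|²m_𝔇 + 2|ι|oβ)·e^{−δd}`. [cite: Balaban1985BackgroundPropagators, (3.42) p.397 (shape)] -/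
theorem hasMaj_idef_gaugeConj_exp {T' : (X' × ι → ℝ) →ₗ[ℝ] (X' × ι → ℝ)} {T : (X × ι → ℝ) →ₗ[ℝ] (X × ι → ℝ)} {β mD o δ : ℝ} (hβ : 0 ≤ β) (hmD : 0 ≤ mD) (ho : 0 ≤ o)
    (hWt1 : ∀ x i j, |(W x)ᵀ i j| ≤ 1) (hW1' : ∀ x' i j, |W' x' i j| ≤ 1)
    (hfit : ∀ x' i, ∑ j, |W' x' i j - W (π x') i j| ≤ o) (hfitT : ∀ x' i, ∑ j, |(W' x')ᵀ i j - (W (π x'))ᵀ i j| ≤ o)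
    (hT : HasMaj (BlockNorm.ofBlocks g (liftBlk blk ι)) (BlockNorm.ofBlocks g (liftBlk blk ι)) T (fun y y' => β * Real.exp (-(δ * g.dist y y'))))
    (hT' : HasMaj (BlockNorm.ofBlocks g (liftBlk (blk ∘ π) ι)) (BlockNorm.ofBlocks g (liftBlk (blk ∘ π) ι)) T' (fun y y' => β * Real.exp (-(δ * g.dist y y'))))
    (hDT : HasMaj (BlockNorm.ofBlocks g (liftBlk blk ι)) (BlockNorm.ofBlocks g (liftBlk (blk ∘ π) ι)) (idef (pull (liftMap π ι)) (pull (liftMap π ι)) T' T)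
      (fun y y' => mD * Real.exp (-(δ * g.dist y y')))) :
    HasMaj (BlockNorm.ofBlocks g (liftBlk blk ι)) (BlockNorm.ofBlocks g (liftBlk (blk ∘ π) ι))
      (idef (pull (liftMap π ι)) (pull (liftMap π ι)) (mmulOp W' ∘ₗ T' ∘ₗ mmulOp (fun x' => (W' x')ᵀ)) (mmulOp W ∘ₗ T ∘ₗ mmulOp (fun x => (W x)ᵀ)))
      (fun y y' => ((Fintype.card ι : ℝ) ^ 2 * mD + 2 * (Fintype.card ι : ℝ) * o * β) * Real.exp (-(δ * g.dist y y'))) := by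
  have h := hasMaj_idef_gaugeConj π W W' blk (o := fun _ => o) (fun _ _ => mul_nonneg hβ (Real.exp_nonneg _)) (fun _ _ => mul_nonneg hβ (Real.exp_nonneg _))
    (fun _ _ => mul_nonneg hmD (Real.exp_nonneg _)) (fun _ => ho) hWt1 hW1' (fun x' i => hfit x' i) (fun x' i => hfitT x' i) hT hT' hDT
  refine h.mono fun y y' => le_of_eq ?_
  ring

end TwoGrids

end Summit.QuantumFields.YangMills.BalabanUVNodes.N15.CurvedSpecies

end
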